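import Mathlib.RingTheory.Valuation.LocalSubring
import Mathlib.RingTheory.Jacobson.Ring
import Mathlib.RingTheory.LocalRing.ResidueField.Basic
import Mathlib.FieldTheory.Minpoly.Field
import Mathlib.RingTheory.Adjoin.FG
import Mathlib.RingTheory.FiniteType
import Literature.AlgebraicGeometry.Resolution.CompositeValuations
import HarnessLib

/-!
# Refining a valuation ring that is not zero-dimensional
# (crux `IndSmooth.ValuativeSmoothing`, line `birth`, stub `stub_refineOfNotZeroDim`)

Stub `stub_refineOfNotZeroDim` of the skeleton `Lines/birth.lean` (lead reshape r1) for crux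
stmt-ResolutionOfSingularities-16087: for a field extension `K/k`, a valuation subring `O` of `K`
and a finitely generated `k`-subalgebra `R ⊆ O`, if `O` is NOT zero-dimensional over `k` — some
`x ∈ O` has `f(x) ∉ m_O` for every non-zero `f ∈ k[X]`, i.e. the residue `x̄ ∈ κ(O)` is
transcendental over `k` — then there is a valuation subring `O' ⊊ O` of `K` still containing `R`.

Proof (Zariski–Samuel II, Ch. VI § 3, composite valuations). Let `A = k[s, x] ⊆ O` for a finite
generating set `s` of `R`, and `ρ : A → κ(O)` the residue map. Its image `ρ(A)` is a finitely
generated `k`-algebra containing the transcendental `x̄`, hence is not a field: for a maximal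
ideal `m ⊇ ker ρ` of `A`, Zariski's lemma (Mathlib `finite_of_finite_type_of_isJacobsonRing`)
makes `A ⧸ m` finite over `k`, so `x` satisfies a monic `P ∈ k[X]` modulo `m`; then
`a = P(x) ∈ m` but `ρ(a) = P(x̄) ≠ 0`. The proper ideal `m · ρ(A)` of the subring `ρ(A) ⊆ κ(O)`
is centred in a valuation subring `O₁` of `κ(O)` (Chevalley, Mathlib
`Ideal.image_subset_nonunits_valuationSubring`), with `ρ(a)` a non-zero non-unit of `O₁`. The
composite `O' = {y ∈ O | ȳ ∈ O₁}` (tree `Literature…Resolution.residueOverringLift O O₁`) is a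
valuation subring of `K` inside `O`, contains `R` (residues of `R ⊆ A` lie in `ρ(A) ⊆ O₁`), and
omits `a⁻¹ ∈ O` (its residue `ρ(a)⁻¹` is not in `O₁`), so `O' ≠ O`.

This is the second half of the reduction of the crux to ZERO-DIMENSIONAL valuation rings: a
MINIMAL valuation subring between `R` and `O` (companion stub `stub_existsMinimal`) is
zero-dimensional over `k`. Pure valuation theory; no perfectness or finite generation of `K` used.
-/

-- single-problem summit: the doubled namespace component is forced
set_option linter.dupNamespace false

open scoped Polynomial
open IsLocalRing

namespace Summit.ResolutionOfSingularities.ResolutionOfSingularities.Theorems.ValuativeSmoothing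

/-- **Stub `stub_refineOfNotZeroDim` (line `birth`, crux `IndSmooth.ValuativeSmoothing`).** For a
valuation subring `O` of the field `K ⊇ k` and a finitely generated `k`-subalgebra `R ⊆ O`: if
`O` is not zero-dimensional over `k` (not every `x ∈ O` has `f(x) ∈ m_O` for some non-zero
`f ∈ k[X]`, i.e. some residue `x̄ ∈ κ(O)` is transcendental over `k`), then some valuation subring
`O' ≤ O`, `O' ≠ O`, still contains `R` — the composite of `O` with a non-trivial valuation ring of
`κ(O)` containing the residues of `R` (Zariski's lemma + Chevalley's extension theorem).
[folklore] -/
theorem stub_refineOfNotZeroDim (k K : Type) [Field k] [Field K] [Algebra k K]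
    (O : ValuationSubring K) (R : Subalgebra k K) (hR : R.FG) (hRO : R.toSubring ≤ O.toSubring)
    (hZ : ¬ ∀ x ∈ O, ∃ f : k[X], f ≠ 0 ∧ Polynomial.aeval x f ∈ O.nonunits) :
    ∃ O' : ValuationSubring K, R.toSubring ≤ O'.toSubring ∧ O' ≤ O ∧ O' ≠ O := by
  classical
  -- `k ⊆ R ⊆ O`
  have hk : ∀ c : k, algebraMap k K c ∈ O := fun c => hRO (R.algebraMap_mem c)
  -- a residually transcendental element `x ∈ O`
  push Not at hZ
  obtain ⟨x, hxO, hxZ⟩ := hZ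
  -- a finite generating set `s` of `R`
  obtain ⟨s, rfl⟩ := hR
  have hsO : (s : Set K) ⊆ O := fun y hy => hRO (Algebra.subset_adjoin hy)
  -- `A = k[s, x]`, a finitely generated `k`-subalgebra of `K` with `R ⊆ A ⊆ O`, `x ∈ A`
  set A : Subalgebra k K := Algebra.adjoin k (insert x (s : Set K)) with hA_def
  have hRA : Algebra.adjoin k (s : Set K) ≤ A := Algebra.adjoin_mono (Set.subset_insert _ _)
  have hxA : x ∈ A := Algebra.subset_adjoin (Set.mem_insert _ _)
  have hAO : ∀ y ∈ A, y ∈ O := by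
    intro y hy
    have hy' : y ∈ A.toSubring := hy
    rw [hA_def, Algebra.adjoin_eq_ring_closure] at hy'
    exact Subring.closure_le.mpr
      (Set.union_subset (Set.range_subset_iff.mpr hk) (Set.insert_subset hxO hsO)) hy'
  haveI hAft : Algebra.FiniteType k A :=
    Algebra.FiniteType.adjoin_of_finite ((s.finite_toSet).insert x)
  -- the `k`-algebra structure on `O` (and the induced one on its residue field `κ(O)`)
  letI : Algebra k O := ((algebraMap k K).codRestrict O hk).toAlgebra
  -- the inclusion `A → O` and the residue map `ρ : A → κ(O)` as `k`-algebra maps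
  let ι : A →ₐ[k] O :=
    { toFun := fun y => ⟨y, hAO y y.2⟩
      map_one' := rfl
      map_mul' := fun _ _ => rfl
      map_zero' := rfl
      map_add' := fun _ _ => rfl
      commutes' := fun _ => rfl }
  let ρ : A →ₐ[k] ResidueField O := (IsScalarTower.toAlgHom k O (ResidueField O)).comp ι
  have hρ : ∀ y : A, ρ y = residue O ⟨y, hAO y y.2⟩ := fun y => rfl
  -- `x` as an element of `A`; polynomials in `x` computed in `A` and in `K` agree
  obtain ⟨xA, hxA_def⟩ : ∃ xA : A, xA = ⟨x, hxA⟩ := ⟨_, rfl⟩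
  have haevalA : ∀ P : k[X], ((Polynomial.aeval xA P : A) : K) = Polynomial.aeval x P := by
    intro P
    have h := (Polynomial.aeval_algHom_apply A.val xA P).symm
    rw [hxA_def] at h ⊢
    exact h
  -- `x̄ = ρ xA` is transcendental over `k`
  have htr : ∀ P : k[X], P ≠ 0 → ρ (Polynomial.aeval xA P) ≠ 0 := by
    intro P hP h0
    rw [hρ, residue_eq_zero_iff, ValuationSubring.valuation_lt_one_iff] at h0
    apply hxZ P hP
    rw [ValuationSubring.mem_nonunits_iff, ← haevalA P]
    exact h0
  -- Zariski's lemma: a maximal ideal `m ⊇ ker ρ` of `A` and `a ∈ m` with `ρ a ≠ 0`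
  obtain ⟨m, hm, hpm⟩ :=
    Ideal.exists_le_maximal (RingHom.ker ρ.toRingHom) (RingHom.ker_ne_top _)
  obtain ⟨a, ham, hρa⟩ : ∃ a : A, a ∈ m ∧ ρ a ≠ 0 := by
    haveI := hm
    have hint : IsIntegral k (Ideal.Quotient.mkₐ k m xA) := by
      letI : Field (A ⧸ m) := Ideal.Quotient.field m
      haveI : Module.Finite k (A ⧸ m) := finite_of_finite_type_of_isJacobsonRing k (A ⧸ m)
      exact IsIntegral.of_finite k _
    refine ⟨Polynomial.aeval xA (minpoly k (Ideal.Quotient.mkₐ k m xA)), ?_,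
      htr _ (minpoly.ne_zero hint)⟩
    rw [← Ideal.Quotient.eq_zero_iff_mem, ← Ideal.Quotient.mkₐ_eq_mk k,
      ← Polynomial.aeval_algHom_apply]
    exact minpoly.aeval k _
  -- `a ∈ O` is a unit of `O` with non-zero residue `ρ a`
  have haO : (a : K) ∈ O := hAO a a.2
  have hρa' : residue O ⟨(a : K), haO⟩ = ρ a := rfl
  have ha0 : (a : K) ≠ 0 := by
    intro h
    apply hρa
    have : a = 0 := Subtype.ext h
    rw [this, map_zero]
  have hau : IsUnit (⟨(a : K), haO⟩ : O) := by
    rw [← residue_ne_zero_iff_isUnit, hρa']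
    exact hρa
  have hai : (a : K)⁻¹ ∈ O :=
    Literature.AlgebraicGeometry.Resolution.inv_mem_of_isUnit O haO hau
  -- Chevalley: a valuation subring `O₁` of `κ(O)` containing `ρ(A)` and centred on `m · ρ(A)`
  set f : A →+* ρ.toRingHom.range := ρ.toRingHom.rangeRestrict with hf_def
  have hf : Function.Surjective f := RingHom.rangeRestrict_surjective _
  have hI : Ideal.map f m ≠ ⊤ := by
    intro htop
    have h1 : (1 : ρ.toRingHom.range) ∈ Ideal.map f m := htop ▸ Submodule.mem_top
    rw [Ideal.mem_map_iff_of_surjective f hf] at h1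
    obtain ⟨b, hb, hb1⟩ := h1
    have hb' : b - 1 ∈ RingHom.ker f := by
      rw [RingHom.mem_ker, map_sub, hb1, map_one, sub_self]
    rw [hf_def, RingHom.ker_rangeRestrict] at hb'
    have h1m : (1 : A) ∈ m := by
      have := m.sub_mem hb (hpm hb')
      rwa [sub_sub_cancel] at this
    exact hm.ne_top ((Ideal.eq_top_iff_one m).mpr h1m)
  obtain ⟨O₁, hA₁O₁, hIO₁⟩ := Ideal.image_subset_nonunits_valuationSubring (Ideal.map f m) hI
  have hρaO₁ : ρ a ∈ O₁.nonunits := by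
    apply hIO₁
    exact (Set.mem_image _ _ _).mpr ⟨f a, Ideal.mem_map_of_mem f ham, rfl⟩
  -- the composite valuation ring `O' = {y ∈ O | ȳ ∈ O₁}`
  refine ⟨Literature.AlgebraicGeometry.Resolution.residueOverringLift O O₁, ?_,
    Literature.AlgebraicGeometry.Resolution.residueOverringLift_le O O₁, ?_⟩
  · -- `R ⊆ O'`: residues of `R ⊆ A` lie in `ρ(A) ⊆ O₁`
    intro y hy
    have hyA : y ∈ A := hRA (Subalgebra.mem_toSubring.mp hy)
    change y ∈ Literature.AlgebraicGeometry.Resolution.residueOverringLift O O₁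
    rw [Literature.AlgebraicGeometry.Resolution.mem_residueOverringLift_iff]
    refine ⟨hAO y hyA, hA₁O₁ ?_⟩
    exact RingHom.mem_range.mpr ⟨⟨y, hyA⟩, rfl⟩
  · -- `O' ≠ O`: `a⁻¹ ∈ O` but `a⁻¹ ∉ O'` since `ρ(a)⁻¹ ∉ O₁`
    intro hEq
    have hmem : (a : K)⁻¹ ∈ Literature.AlgebraicGeometry.Resolution.residueOverringLift O O₁ := by
      rw [hEq]; exact hai
    rw [Literature.AlgebraicGeometry.Resolution.mem_residueOverringLift_iff] at hmem
    obtain ⟨hai', hmem⟩ := hmem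
    rw [Literature.AlgebraicGeometry.Resolution.residue_mk_inv O haO hai' ha0, hρa'] at hmem
    rcases O₁.mem_nonunits_iff_or.mp hρaO₁ with h | h
    · exact hρa h
    · exact h hmem

end Summit.ResolutionOfSingularities.ResolutionOfSingularities.Theorems.ValuativeSmoothing
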